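import Mathlib
import Literature.Analysis.FluidPDE.PoincareBall

/-!
# Lower semicontinuity of the local Dirichlet energy under pointwise convergence

Helper file for crux `LandauTailBlowup` (stmt-NavierStokesRegularity-1944), line `registered`,
registered stub `landauTail_dirichlet_lsc` (B1, "lower semicontinuity of the local Dirichlet
energy under pointwise convergence to a `C¹` limit"): if `v n : ℝ³ → ℝ³` are `C¹`, `V` is `C¹`
on the ball `B(x₀, δ + η)` and `v n → V` pointwise on that ball, then
`∫_{B(x₀,δ)} ‖DV‖² ≤ 3 · liminf_n ∫_{B(x₀,δ+η)} ‖Dv_n‖²` (operator norms, extended-valued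
integrals).  No norm control of the convergence is assumed: the proof uses only the segment
estimate, translation invariance of Lebesgue measure and Fatou's lemma (twice).

* `landauTail_dirichletLsc_setLIntegral_add_le`: `∫_{B(x₀,δ)} G(x + w) ≤ ∫_{B(x₀,δ+η)} G` for
  `‖w‖ < η` (translation invariance);
* `landauTail_dirichletLsc_quotient_le`: for `f ∈ C¹`, `‖e‖ ≤ 1`, `0 < h < η`,
  `∫_{B(x₀,δ)} ‖h⁻¹(f(x + h e) − f x)‖² ≤ ∫_{B(x₀,δ+η)} ‖Df‖²` (half-segment FTC bound
  `Literature.Analysis.FluidPDE.PoincareBall.enorm_sub_sq_le_halfEnergy` with `b = x + 2h e`,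
  Tonelli, translation);
* `landauTail_dirichletLsc_direction`: `∫_{B(x₀,δ)} ‖DV(x) e‖² ≤ liminf_n ∫_{B(x₀,δ+η)} ‖Dv_n‖²`
  (Fatou in `n` on the difference quotients, then Fatou in `h → 0⁺`, `HasFDerivAt.lim`);
* `landauTail_dirichletLsc_enorm_sq_le_sum`: `‖L‖² ≤ Σᵢ ‖L bᵢ‖²` for an orthonormal basis;
* `landauTail_dirichlet_lsc`: sum over the three coordinate directions.
-/

set_option linter.dupNamespace false

namespace Summit.NavierStokesRegularity.NavierStokesRegularity.Theorems

open MeasureTheory Set Filter Topology Metric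
open scoped ENNReal NNReal RealInnerProductSpace

/-- **Operator norm versus frame sum** [folklore]: `‖L‖² ≤ Σᵢ ‖L bᵢ‖²` for an orthonormal basis
`b` of `ℝ³` (Cauchy–Schwarz on `L x = Σᵢ ⟪bᵢ, x⟫ L bᵢ`). -/
-- adapted from `Literature.Analysis.FluidPDE.TaoEnstrophyLocalisationProofs`
-- (`sq_opNorm_le_sum_sq_norm_apply`), re-proved here to keep the imports light.
theorem landauTail_dirichletLsc_sq_opNorm_le_sum {ι : Type*} [Fintype ι]
    (b : OrthonormalBasis ι ℝ (EuclideanSpace ℝ (Fin 3)))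
    (L : EuclideanSpace ℝ (Fin 3) →L[ℝ] EuclideanSpace ℝ (Fin 3)) :
    ‖L‖ ^ 2 ≤ ∑ i, ‖L (b i)‖ ^ 2 := by
  have hnn : 0 ≤ ∑ i, ‖L (b i)‖ ^ 2 := Finset.sum_nonneg fun i _ => sq_nonneg _
  have hop : ‖L‖ ≤ Real.sqrt (∑ i, ‖L (b i)‖ ^ 2) := by
    refine ContinuousLinearMap.opNorm_le_bound _ (Real.sqrt_nonneg _) fun x => ?_
    have hx : L x = ∑ i, ⟪x, b i⟫ • L (b i) := by
      conv_lhs => rw [← b.sum_repr' x]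
      simp [map_sum, map_smul, real_inner_comm]
    rw [hx]
    calc ‖∑ i, ⟪x, b i⟫ • L (b i)‖ ≤ ∑ i, ‖⟪x, b i⟫ • L (b i)‖ := norm_sum_le _ _
      _ = ∑ i, |⟪x, b i⟫| * ‖L (b i)‖ := by simp [norm_smul]
      _ ≤ Real.sqrt (∑ i, |⟪x, b i⟫| ^ 2) * Real.sqrt (∑ i, ‖L (b i)‖ ^ 2) :=
          Real.sum_mul_le_sqrt_mul_sqrt _ _ _
      _ = ‖x‖ * Real.sqrt (∑ i, ‖L (b i)‖ ^ 2) := by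
          rw [show ∑ i, |⟪x, b i⟫| ^ 2 = ∑ i, ⟪x, b i⟫ ^ 2 from
            Finset.sum_congr rfl fun i _ => sq_abs _, b.sum_sq_inner_left,
            Real.sqrt_sq (norm_nonneg _)]
      _ = Real.sqrt (∑ i, ‖L (b i)‖ ^ 2) * ‖x‖ := mul_comm _ _
  calc ‖L‖ ^ 2 ≤ Real.sqrt (∑ i, ‖L (b i)‖ ^ 2) ^ 2 := pow_le_pow_left₀ (norm_nonneg _) hop 2
    _ = ∑ i, ‖L (b i)‖ ^ 2 := Real.sq_sqrt hnn

/-- Extended-valued form of `landauTail_dirichletLsc_sq_opNorm_le_sum` [folklore]: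
`‖L‖ₑ² ≤ Σᵢ ‖L bᵢ‖ₑ²` for an orthonormal basis `b` of `ℝ³`. -/
theorem landauTail_dirichletLsc_enorm_sq_le_sum {ι : Type*} [Fintype ι]
    (b : OrthonormalBasis ι ℝ (EuclideanSpace ℝ (Fin 3)))
    (L : EuclideanSpace ℝ (Fin 3) →L[ℝ] EuclideanSpace ℝ (Fin 3)) :
    ‖L‖ₑ ^ 2 ≤ ∑ i, ‖L (b i)‖ₑ ^ 2 := by
  have h := landauTail_dirichletLsc_sq_opNorm_le_sum b L
  calc ‖L‖ₑ ^ 2 = ENNReal.ofReal (‖L‖ ^ 2) := by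
        rw [ENNReal.ofReal_pow (norm_nonneg _), ofReal_norm]
    _ ≤ ENNReal.ofReal (∑ i, ‖L (b i)‖ ^ 2) := ENNReal.ofReal_le_ofReal h
    _ = ∑ i, ‖L (b i)‖ₑ ^ 2 := by
        rw [ENNReal.ofReal_sum_of_nonneg (fun i _ => sq_nonneg _)]
        exact Finset.sum_congr rfl fun i _ => by
          rw [ENNReal.ofReal_pow (norm_nonneg _), ofReal_norm]

/-- **Translation of a ball into a larger ball** [folklore]: for `‖w‖ < η` and `G ≥ 0`,
`∫_{B(x₀,δ)} G(x + w) dx ≤ ∫_{B(x₀,δ+η)} G` (the translate of `B(x₀, δ)` by `w` lies in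
`B(x₀, δ + η)`, and Lebesgue measure is translation invariant). -/
theorem landauTail_dirichletLsc_setLIntegral_add_le (G : EuclideanSpace ℝ (Fin 3) → ℝ≥0∞)
    (x₀ w : EuclideanSpace ℝ (Fin 3)) {δ η : ℝ} (hw : ‖w‖ < η) :
    ∫⁻ x in ball x₀ δ, G (x + w) ≤ ∫⁻ x in ball x₀ (δ + η), G x := by
  rw [← lintegral_indicator measurableSet_ball, ← lintegral_indicator measurableSet_ball]
  have hpt : ∀ x, (ball x₀ δ).indicator (fun x => G (x + w)) x ≤
      (ball x₀ (δ + η)).indicator G (x + w) := by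
    intro x
    by_cases hx : x ∈ ball x₀ δ
    · rw [indicator_of_mem hx]
      have hmem : x + w ∈ ball x₀ (δ + η) := by
        rw [mem_ball, dist_eq_norm] at hx ⊢
        calc ‖x + w - x₀‖ = ‖(x - x₀) + w‖ := by abel_nf
          _ ≤ ‖x - x₀‖ + ‖w‖ := norm_add_le _ _
          _ < δ + η := add_lt_add hx hw
      rw [indicator_of_mem hmem]
    · rw [indicator_of_notMem hx]
      exact zero_le
  calc ∫⁻ x, (ball x₀ δ).indicator (fun x => G (x + w)) x
      ≤ ∫⁻ x, (ball x₀ (δ + η)).indicator G (x + w) := lintegral_mono hpt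
    _ = ∫⁻ x, (ball x₀ (δ + η)).indicator G x := lintegral_add_right_eq_self _ w

/-- **Integrated difference quotients are bounded by the Dirichlet energy** [folklore]: for
`f ∈ C¹(ℝ³; ℝ³)`, `‖e‖ ≤ 1` and `0 < h < η`,
`∫_{B(x₀,δ)} ‖h⁻¹ (f(x + h e) − f(x))‖ₑ² dx ≤ ∫_{B(x₀,δ+η)} ‖Df‖ₑ²`.
Proof: the half-segment bound `enorm_sub_sq_le_halfEnergy` with `b = x + 2h e` gives
`‖f(x + h e) − f x‖² ≤ ½ · 4h² ∫₀^{1/2} ‖Df(x + 2τh e)‖² dτ`; integrate in `x`, swap (Tonelli) and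
translate (`landauTail_dirichletLsc_setLIntegral_add_le`, `2τh ≤ h < η`). -/
theorem landauTail_dirichletLsc_quotient_le
    {f : EuclideanSpace ℝ (Fin 3) → EuclideanSpace ℝ (Fin 3)} (hf : ContDiff ℝ 1 f)
    (x₀ e : EuclideanSpace ℝ (Fin 3)) (he : ‖e‖ ≤ 1) {δ η h : ℝ} (hh : 0 < h) (hhη : h < η) :
    ∫⁻ x in ball x₀ δ, ‖h⁻¹ • (f (x + h • e) - f x)‖ₑ ^ 2 ≤
      ∫⁻ x in ball x₀ (δ + η), ‖fderiv ℝ f x‖ₑ ^ 2 := by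
  set G : EuclideanSpace ℝ (Fin 3) → ℝ≥0∞ := fun x => ‖fderiv ℝ f x‖ₑ ^ 2 with hG
  set I : EuclideanSpace ℝ (Fin 3) → ℝ≥0∞ := fun a =>
    ∫⁻ τ in Icc (0 : ℝ) 2⁻¹, G (a + τ • ((2 * h) • e)) with hI
  -- the pointwise bound
  have hne : ‖(2 * h) • e‖ₑ ^ 2 ≤ ENNReal.ofReal ((2 * h) ^ 2) := by
    rw [← ofReal_norm, ← ENNReal.ofReal_pow (norm_nonneg _)]
    refine ENNReal.ofReal_le_ofReal (pow_le_pow_left₀ (norm_nonneg _) ?_ 2)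
    rw [norm_smul, Real.norm_eq_abs, abs_of_pos (by positivity)]
    calc 2 * h * ‖e‖ ≤ 2 * h * 1 := by gcongr
      _ = 2 * h := mul_one _
  have hinv : ‖h⁻¹‖ₑ ^ 2 * (2⁻¹ * ENNReal.ofReal ((2 * h) ^ 2)) = 2 := by
    have h2 : (2⁻¹ : ℝ≥0∞) = ENNReal.ofReal 2⁻¹ := by
      rw [ENNReal.ofReal_inv_of_pos two_pos, ENNReal.ofReal_ofNat]
    rw [Real.enorm_eq_ofReal (inv_nonneg.2 hh.le), ← ENNReal.ofReal_pow (inv_nonneg.2 hh.le), h2,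
      ← ENNReal.ofReal_mul (by positivity), ← ENNReal.ofReal_mul (by positivity)]
    have hreal : h⁻¹ ^ 2 * (2⁻¹ * (2 * h) ^ 2) = (2 : ℝ) :=
      calc h⁻¹ ^ 2 * (2⁻¹ * (2 * h) ^ 2) = 2 * (h⁻¹ * h) ^ 2 := by ring
        _ = 2 := by rw [inv_mul_cancel₀ hh.ne', one_pow, mul_one]
    rw [hreal, ENNReal.ofReal_ofNat]
  have hpt : ∀ a, ‖h⁻¹ • (f (a + h • e) - f a)‖ₑ ^ 2 ≤ 2 * I a := by
    intro a
    have h0 := Literature.Analysis.FluidPDE.PoincareBall.enorm_sub_sq_le_halfEnergy hf a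
      (a + (2 * h) • e)
    have h2 : a + (2⁻¹ : ℝ) • (a + (2 * h) • e - a) = a + h • e := by
      rw [add_sub_cancel_left, smul_smul, inv_mul_cancel_left₀ two_ne_zero]
    rw [h2, add_sub_cancel_left] at h0
    have h0' : ‖f (a + h • e) - f a‖ₑ ^ 2 ≤ 2⁻¹ * (ENNReal.ofReal ((2 * h) ^ 2) * I a) :=
      h0.trans (mul_le_mul_right (mul_le_mul_left hne (I a)) _)
    calc ‖h⁻¹ • (f (a + h • e) - f a)‖ₑ ^ 2 = ‖h⁻¹‖ₑ ^ 2 * ‖f (a + h • e) - f a‖ₑ ^ 2 := by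
          rw [enorm_smul, mul_pow]
      _ ≤ ‖h⁻¹‖ₑ ^ 2 * (2⁻¹ * (ENNReal.ofReal ((2 * h) ^ 2) * I a)) :=
          mul_le_mul_right h0' _
      _ = ‖h⁻¹‖ₑ ^ 2 * (2⁻¹ * ENNReal.ofReal ((2 * h) ^ 2)) * I a := by ring
      _ = 2 * I a := by rw [hinv]
  -- joint measurability of `(a, τ) ↦ G (a + τ • 2h e)`
  have hmeas : Measurable (Function.uncurry fun (a : EuclideanSpace ℝ (Fin 3)) (τ : ℝ) =>
      G (a + τ • ((2 * h) • e))) := by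
    have hc : Continuous fun p : EuclideanSpace ℝ (Fin 3) × ℝ =>
        fderiv ℝ f (p.1 + p.2 • ((2 * h) • e)) :=
      (hf.continuous_fderiv one_ne_zero).comp (by fun_prop)
    exact hc.measurable.enorm.pow_const 2
  -- translation, slice by slice
  have htrans : ∀ τ ∈ Icc (0 : ℝ) 2⁻¹,
      ∫⁻ a in ball x₀ δ, G (a + τ • ((2 * h) • e)) ≤ ∫⁻ y in ball x₀ (δ + η), G y := by
    intro τ hτ
    refine landauTail_dirichletLsc_setLIntegral_add_le G x₀ _ ?_
    rw [norm_smul, norm_smul, Real.norm_eq_abs, Real.norm_eq_abs, abs_of_nonneg hτ.1,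
      abs_of_pos (by positivity : (0 : ℝ) < 2 * h)]
    calc τ * (2 * h * ‖e‖) ≤ 2⁻¹ * (2 * h * 1) := by
          gcongr
          exact hτ.2
      _ = h := by ring
      _ < η := hhη
  calc ∫⁻ x in ball x₀ δ, ‖h⁻¹ • (f (x + h • e) - f x)‖ₑ ^ 2
      ≤ ∫⁻ x in ball x₀ δ, 2 * I x := lintegral_mono fun x => hpt x
    _ = 2 * ∫⁻ x in ball x₀ δ, I x := lintegral_const_mul' _ _ ENNReal.ofNat_ne_top
    _ = 2 * ∫⁻ τ in Icc (0 : ℝ) 2⁻¹, ∫⁻ x in ball x₀ δ, G (x + τ • ((2 * h) • e)) := by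
        rw [lintegral_lintegral_swap hmeas.aemeasurable]
    _ ≤ 2 * ∫⁻ τ in Icc (0 : ℝ) 2⁻¹, ∫⁻ y in ball x₀ (δ + η), G y := by
        gcongr 2 * ?_
        exact setLIntegral_mono' measurableSet_Icc fun τ hτ => htrans τ hτ
    _ = ∫⁻ y in ball x₀ (δ + η), G y := by
        rw [setLIntegral_const, Real.volume_Icc, sub_zero, ENNReal.ofReal_inv_of_pos two_pos,
          ENNReal.ofReal_ofNat]
        calc 2 * ((∫⁻ y in ball x₀ (δ + η), G y) * 2⁻¹)
            = (2 * 2⁻¹) * ∫⁻ y in ball x₀ (δ + η), G y := by ring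
          _ = ∫⁻ y in ball x₀ (δ + η), G y := by
            rw [ENNReal.mul_inv_cancel two_ne_zero ENNReal.ofNat_ne_top, one_mul]

/-- **Directional lower semicontinuity** [folklore]: under the hypotheses of
`landauTail_dirichlet_lsc` and for `‖e‖ ≤ 1`,
`∫_{B(x₀,δ)} ‖DV(x) e‖ₑ² ≤ liminf_n ∫_{B(x₀,δ+η)} ‖Dv_n‖ₑ²`.
Proof: for fixed `0 < h < η`, Fatou in `n` applied to the (continuous) difference quotients
`‖h⁻¹(v_n(x + h e) − v_n x)‖²`, which converge pointwise on `B(x₀, δ)` and whose integrals are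
bounded by `landauTail_dirichletLsc_quotient_le`; then Fatou in `h = η/(m+2) → 0`, the quotients
of `V` converging to `DV(x) e` on the open ball where `V` is differentiable (`HasFDerivAt.lim`). -/
theorem landauTail_dirichletLsc_direction
    (v : ℕ → EuclideanSpace ℝ (Fin 3) → EuclideanSpace ℝ (Fin 3))
    (V : EuclideanSpace ℝ (Fin 3) → EuclideanSpace ℝ (Fin 3)) (x₀ : EuclideanSpace ℝ (Fin 3))
    {δ η : ℝ} (hη : 0 < η) (hv : ∀ n, ContDiff ℝ 1 (v n))
    (hV : ContDiffOn ℝ 1 V (ball x₀ (δ + η)))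
    (hlim : ∀ x ∈ ball x₀ (δ + η), Tendsto (fun n => v n x) atTop (𝓝 (V x)))
    (e : EuclideanSpace ℝ (Fin 3)) (he : ‖e‖ ≤ 1) :
    ∫⁻ x in ball x₀ δ, ‖fderiv ℝ V x e‖ₑ ^ 2 ≤
      liminf (fun n => ∫⁻ x in ball x₀ (δ + η), ‖fderiv ℝ (v n) x‖ₑ ^ 2) atTop := by
  set L := liminf (fun n => ∫⁻ x in ball x₀ (δ + η), ‖fderiv ℝ (v n) x‖ₑ ^ 2) atTop with hL
  have hsub : ball x₀ δ ⊆ ball x₀ (δ + η) := ball_subset_ball (by linarith)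
  have hmem : ∀ {h : ℝ}, 0 ≤ h → h < η → ∀ x ∈ ball x₀ δ, x + h • e ∈ ball x₀ (δ + η) := by
    intro h h0 hη' x hx
    rw [mem_ball, dist_eq_norm] at hx ⊢
    have hhe : ‖h • e‖ ≤ h := by
      rw [norm_smul, Real.norm_eq_abs, abs_of_nonneg h0]
      nlinarith [norm_nonneg e]
    calc ‖x + h • e - x₀‖ = ‖(x - x₀) + h • e‖ := by abel_nf
      _ ≤ ‖x - x₀‖ + ‖h • e‖ := norm_add_le _ _
      _ < δ + η := add_lt_add hx (hhe.trans_lt hη')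
  -- Step 1: Fatou in `n` at fixed `h`
  have step1 : ∀ h : ℝ, 0 < h → h < η →
      ∫⁻ x in ball x₀ δ, ‖h⁻¹ • (V (x + h • e) - V x)‖ₑ ^ 2 ≤ L := by
    intro h hh hhη
    have hwmeas : ∀ n, Measurable fun x => ‖h⁻¹ • (v n (x + h • e) - v n x)‖ₑ ^ 2 := by
      intro n
      have hvc : Continuous (v n) := (hv n).continuous
      have hc : Continuous fun x => h⁻¹ • (v n (x + h • e) - v n x) := by fun_prop
      exact hc.measurable.enorm.pow_const 2
    have hwlim : ∀ x ∈ ball x₀ δ, Tendsto (fun n => ‖h⁻¹ • (v n (x + h • e) - v n x)‖ₑ ^ 2)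
        atTop (𝓝 (‖h⁻¹ • (V (x + h • e) - V x)‖ₑ ^ 2)) := by
      intro x hx
      have h1 : Tendsto (fun n => v n (x + h • e)) atTop (𝓝 (V (x + h • e))) :=
        hlim _ (hmem hh.le hhη x hx)
      have h2 : Tendsto (fun n => v n x) atTop (𝓝 (V x)) := hlim _ (hsub hx)
      exact ENNReal.Tendsto.pow (((h1.sub h2).const_smul h⁻¹).enorm)
    calc ∫⁻ x in ball x₀ δ, ‖h⁻¹ • (V (x + h • e) - V x)‖ₑ ^ 2
        = ∫⁻ x in ball x₀ δ,
            liminf (fun n => ‖h⁻¹ • (v n (x + h • e) - v n x)‖ₑ ^ 2) atTop :=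
          setLIntegral_congr_fun measurableSet_ball fun x hx => ((hwlim x hx).liminf_eq).symm
      _ ≤ liminf (fun n => ∫⁻ x in ball x₀ δ, ‖h⁻¹ • (v n (x + h • e) - v n x)‖ₑ ^ 2) atTop :=
          lintegral_liminf_le hwmeas
      _ ≤ L := liminf_le_liminf (Eventually.of_forall fun n =>
          landauTail_dirichletLsc_quotient_le (hv n) x₀ e he hh hhη)
  -- Step 2: Fatou in `h = (c m)⁻¹ → 0⁺`
  set c : ℕ → ℝ := fun m => ((m : ℝ) + 2) / η with hc
  have hcpos : ∀ m, 0 < c m := fun m => by positivity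
  have hcinv_pos : ∀ m, 0 < (c m)⁻¹ := fun m => inv_pos.2 (hcpos m)
  have hcinv_lt : ∀ m, (c m)⁻¹ < η := fun m => by
    rw [hc]
    dsimp only
    rw [inv_div]
    have hm : (0 : ℝ) ≤ m := Nat.cast_nonneg m
    exact div_lt_self hη (by linarith)
  have hctend : Tendsto (fun m => ‖c m‖) atTop atTop := by
    have h1 : Tendsto c atTop atTop :=
      (tendsto_atTop_add_const_right _ _ tendsto_natCast_atTop_atTop).atTop_div_const hη
    refine h1.congr fun m => ?_
    exact (Real.norm_of_nonneg (hcpos m).le).symm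
  have hglim : ∀ x ∈ ball x₀ δ,
      Tendsto (fun m => ‖c m • (V (x + (c m)⁻¹ • e) - V x)‖ₑ ^ 2) atTop
        (𝓝 (‖fderiv ℝ V x e‖ₑ ^ 2)) := by
    intro x hx
    have hdiff : HasFDerivAt V (fderiv ℝ V x) x :=
      ((hV.differentiableOn one_ne_zero).differentiableAt
        (isOpen_ball.mem_nhds (hsub hx))).hasFDerivAt
    exact ENNReal.Tendsto.pow ((hdiff.lim e hctend).enorm)
  have hgmeas : ∀ m, AEMeasurable (fun x => ‖c m • (V (x + (c m)⁻¹ • e) - V x)‖ₑ ^ 2)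
      (volume.restrict (ball x₀ δ)) := by
    intro m
    refine ContinuousOn.aemeasurable ?_ measurableSet_ball
    have hVc : ContinuousOn V (ball x₀ (δ + η)) := hV.continuousOn
    have h1 : ContinuousOn (fun x => V (x + (c m)⁻¹ • e)) (ball x₀ δ) :=
      hVc.comp (by fun_prop) fun x hx => hmem (hcinv_pos m).le (hcinv_lt m) x hx
    have h2 : ContinuousOn V (ball x₀ δ) := hVc.mono hsub
    have h3 : ContinuousOn (fun x => c m • (V (x + (c m)⁻¹ • e) - V x)) (ball x₀ δ) :=
      (h1.sub h2).const_smul (c m)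
    fun_prop
  calc ∫⁻ x in ball x₀ δ, ‖fderiv ℝ V x e‖ₑ ^ 2
      = ∫⁻ x in ball x₀ δ, liminf (fun m => ‖c m • (V (x + (c m)⁻¹ • e) - V x)‖ₑ ^ 2) atTop :=
        setLIntegral_congr_fun measurableSet_ball fun x hx => ((hglim x hx).liminf_eq).symm
    _ ≤ liminf (fun m => ∫⁻ x in ball x₀ δ, ‖c m • (V (x + (c m)⁻¹ • e) - V x)‖ₑ ^ 2) atTop :=
        lintegral_liminf_le' hgmeas
    _ ≤ liminf (fun _ : ℕ => L) atTop := by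
        refine liminf_le_liminf (Eventually.of_forall fun m => ?_)
        have := step1 (c m)⁻¹ (hcinv_pos m) (hcinv_lt m)
        simpa only [inv_inv] using this
    _ = L := liminf_const L

/-- **B1 — lower semicontinuity of the local Dirichlet energy under pointwise convergence to a
`C¹` limit** [folklore; Fatou] (registered support stub of crux stmt-NavierStokesRegularity-1944,
theorem H2 "enstrophy Type II"): if `v n ∈ C¹(ℝ³; ℝ³)`, `V ∈ C¹(B(x₀, δ + η))` and `v n → V`
pointwise on `B(x₀, δ + η)`, then
`∫_{B(x₀,δ)} ‖DV‖ₑ² ≤ 3 · liminf_n ∫_{B(x₀,δ+η)} ‖Dv_n‖ₑ²`.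
Proof: `‖DV(x)‖² ≤ Σ_{i<3} ‖DV(x) eᵢ‖²` for the standard orthonormal basis
(`landauTail_dirichletLsc_enorm_sq_le_sum`) and each direction contributes at most the `liminf`
(`landauTail_dirichletLsc_direction`). -/
theorem landauTail_dirichlet_lsc : ∀ (v : ℕ → EuclideanSpace ℝ (Fin 3) → EuclideanSpace ℝ (Fin 3)) (V : EuclideanSpace ℝ (Fin 3) → EuclideanSpace ℝ (Fin 3)) (x₀ : EuclideanSpace ℝ (Fin 3)) (δ η : ℝ), 0 < δ → 0 < η → (∀ n, ContDiff ℝ 1 (v n)) → ContDiffOn ℝ 1 V (Metric.ball x₀ (δ + η)) → (∀ x ∈ Metric.ball x₀ (δ + η), Filter.Tendsto (fun n => v n x) Filter.atTop (nhds (V x))) → ∫⁻ x in Metric.ball x₀ δ, ‖fderiv ℝ V x‖ₑ ^ 2 ≤ 3 * Filter.liminf (fun n => ∫⁻ x in Metric.ball x₀ (δ + η), ‖fderiv ℝ (v n) x‖ₑ ^ 2) Filter.atTop := by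
  intro v V x₀ δ η _hδ hη hv hV hlim
  set L := liminf (fun n => ∫⁻ x in ball x₀ (δ + η), ‖fderiv ℝ (v n) x‖ₑ ^ 2) atTop with hL
  set b := EuclideanSpace.basisFun (Fin 3) ℝ with hb
  have hdir : ∀ i, ∫⁻ x in ball x₀ δ, ‖fderiv ℝ V x (b i)‖ₑ ^ 2 ≤ L := fun i =>
    landauTail_dirichletLsc_direction v V x₀ hη hv hV hlim (b i) (le_of_eq (b.orthonormal.1 i))
  have hmeas : ∀ i, Measurable fun x => ‖fderiv ℝ V x (b i)‖ₑ ^ 2 := fun i =>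
    (measurable_fderiv_apply_const ℝ V (b i)).enorm.pow_const 2
  calc ∫⁻ x in ball x₀ δ, ‖fderiv ℝ V x‖ₑ ^ 2
      ≤ ∫⁻ x in ball x₀ δ, ∑ i, ‖fderiv ℝ V x (b i)‖ₑ ^ 2 :=
        lintegral_mono fun x => landauTail_dirichletLsc_enorm_sq_le_sum b (fderiv ℝ V x)
    _ = ∑ i, ∫⁻ x in ball x₀ δ, ‖fderiv ℝ V x (b i)‖ₑ ^ 2 :=
        lintegral_finsetSum _ fun i _ => hmeas i
    _ ≤ ∑ _i : Fin 3, L := Finset.sum_le_sum fun i _ => hdir i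
    _ = 3 * L := by
        rw [Finset.sum_const, Finset.card_univ, Fintype.card_fin, nsmul_eq_mul, Nat.cast_ofNat]

end Summit.NavierStokesRegularity.NavierStokesRegularity.Theorems
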